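import Summits.HubbardSuperconductivity.HubbardSuperconductivity.Theses.ChiralWindow
import Summits.HubbardSuperconductivity.HubbardSuperconductivity.Theorems.WcbcsSsbToTorusLRO.Negative.SummitMatrixUniformFloor
import Summits.HubbardSuperconductivity.HubbardSuperconductivity.Theorems.WcbcsSsbToTorusLRO.Negative.BlockRepulsionDominatesPairOrder
import Literature.MathematicalPhysics.QuantumLattice.DWaveSource
import Summits.HubbardSuperconductivity.HubbardSuperconductivity.Theorems.ChiralWindowCwSsbToEvenTorusLROTorusPoincare

/-!
# Line `kac-stiffness-poincare-closure` — lead prover's checked skeleton (v2: S1 `stub_torusPoincare` LANDED p98064 and imported; ONE Kac level, sliding blocks) for crux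
`CwSsbToEvenTorusLRO` (stmt-HubbardSuperconductivity-10439, route `ChiralWindow`; `Iff.rfl`-twin of
`WeakCouplingBCS.WcbcsSsbToTorusLRO`, stmt-2009)

Rebuilt 2026-08-16 by prover-line-stmt-HubbardSuperconductivity-10439-1 from the idea card
`Cruxes/CwSsbToEvenTorusLRO/Ideas/kac-stiffness-poincare-closure.md` and the registered stub NAMES of the planner's skeleton
(`stub_blockRefinementPoincare` / `stub_kacBlockOrderChord` / `stub_chainStiffness`, signatures truncated in the ledger at their first
`let`), because the planner's `Lines/kac-stiffness-poincare-closure.lean` never reached the tree (crux write refused for the truncated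
planner unit; evidence store not mounted in the lead's jail).

Crux: `∃ U₀ > 0, ∀ U ∈ Ioo 0 U₀, ∀ δ ∈ Ioo 0 (1/2), ∀ μ, DensityMatched U δ μ → HasDWaveOrder U μ → (summit matrix at (U, δ))`.

## The line, one Kac level, in the tree's SLIDING-block vocabulary

Blocks of side `R` at EVERY anchor `x` of the torus of side `L` (wrapping around), `B_x = Σ_{u ∈ [0,R)²} P_{x+u}`
(`P_y = localPair dWaveFormFactor L y`; the convention of the landed Fejér closure and of the twin's `W_R = R⁻⁴ Σ_x B_xᴴ B_x`),
so that `Σ_x B_x = R² P` (`sum_blockPair`). For a state `ψ` put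

* block coherence `BC_R(ψ) := re⟨ψ, W_R ψ⟩ / L² = Σ_x ‖B_x ψ‖² / (R⁴ L²)` (`≈ m²` in a d-wave ordered state; `≥ lro(ψ)` always, by the
  twin's landed domination `re_expect_pairIntensity_le_sq_mul_blockRepulsion`);
* block-gradient form `Q_R(ψ) := Σ_x Σ_{i} ‖(B_{x+eᵢ} − B_x) ψ‖² / R⁴` (`≈ 8π² m²` on a winding-one phase texture of the condensate,
  `≈ 4 s₀ L²/R³ → 0` on short-range pair noise iff `R ≫ L^{2/3}` — the card's forced Kac exponent `β > 2/3`);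
* `lro(ψ) := re⟨ψ, P†P ψ⟩ / L⁴`.

Stubs (sorries ONLY in S2/S3; S1 landed):

* `stub_torusPoincare` (S1, finite `L`, provable now; the card's `PoincareClosure` at one level, stated for an ARBITRARY family of
  vectors `v : (ℤ/L)² → ℂ^m`): `L² Σ_x ‖v_x‖² − L⁴ Σ_x Σ_i ‖v_{x+eᵢ} − v_x‖² ≤ ‖Σ_x v_x‖²` (vector-valued discrete Poincaré on the
  2-torus; the elementary path / tensorised 1-D bound gives the constant `L⁴/2`, Fourier gives `L²/(4 sin²(π/L))`; constant `1` is
  registered). With `v_x := B_x ψ` and `Σ_x B_x = R²P`: `lro(ψ) ≥ BC_R(ψ) − Q_R(ψ)`.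
* `stub_kacBlockOrder` (S2, thermodynamic, SSB-fed, GUARDED; the every-ground-state residual of the card's `KacBlockOrder(Chord)`):
  under the crux hypotheses at `(U, δ, μ)` there are a Kac scale `R_L` (`R_L/L → 0`, `R_L³/L² → ∞`) and a floor `a > 0` with
  `BC_{R_L}(ψ) ≥ a` for EVERY normalised `(N_L, 0)`-sector ground state, eventually along the even sides. (The card feeds it through the
  chord `[E_sec(H + g W_R) − E_sec(H)]/(g L²) ≤ BC_R(ψ)` — Danskin, repulsive side; see the lead's dossier for why the chord cannot be
  the supplier at a Kac scale. As registered, S2 is NECESSARY for the crux's conclusion: `lro ≤ BC_R` at every scale.)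
* `stub_stiffness` (S3, O(1), all states, UNGUARDED as in the planner's registration; the card's `StiffnessDomination` at one level):
  for every Kac scale `R_L` and every `η > 0` there is `γ > 0` with `⟨φ, H φ⟩ − E_sec ≥ γ (Q_{R_L}(φ) − η)` for every unit vector `φ`
  of the `(N_L, 0)` sector, eventually along the even sides (sub-critical anti-stiffness stability: rewarding block-phase gradients at
  rate `γ` lowers the sector ground energy by at most `γη`).

COMPOSITION (sorry-free, `CwSsbToEvenTorusLRO_of`): for a sector ground state `ψ`, S3 gives `Q_{R_L}(ψ) ≤ η`; S1 + S2 give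
`lro(ψ) ≥ a − η`; `η := a/2`; the twin's LANDED kernel `hasDWavePairFieldLROAt_of_floor` turns the eventual every-GS floor `a/2` into
the summit matrix at `(U, δ)`, which is the crux's consequent definitionally.

Disproof used (`Cruxes/CwSsbToEvenTorusLRO/Disproof.lean`, gen 3): §1 (no `_false_without_` theorem for either hypothesis; both are
consumed inside S2); §2 (uniform crux shape kept; `_of` concludes the crux BY NAME); §4a (S2 is a GuardedShape — armoured; S3 is
unguarded, `unguarded_conjunct_not_armoured`); §4 (c) lever audit: Poincaré constant checked by the adversary; §3 hazard (first-order
upper coexistence edge) sits inside S2 only; landed Negative lemmas: none shortcut a case here.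
-/

noncomputable section

set_option linter.dupNamespace false

namespace Summit.HubbardSuperconductivity.HubbardSuperconductivity.Cruxes.CwSsbToEvenTorusLRO.KacStiffnessPoincareClosure

open Literature.MathematicalPhysics.QuantumLattice Literature.Barriers.HubbardSuperconductivity
open Summit.HubbardSuperconductivity.WcbcsSsbToTorusLRO.Negative
open Summit.HubbardSuperconductivity.HubbardSuperconductivity.Theorems.CwSsbToEvenTorusLRO (stub_torusPoincare)
open Filter Set Matrix
open scoped Matrix ComplexOrder BigOperators
open _root_.Topology

/-! ## The registered stubs -/

-- Stub S1 `stub_torusPoincare` LANDED (p98064, Theorems/ChiralWindowCwSsbToEvenTorusLROTorusPoincare.lean, stub-worker of this lead) — imported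
-- (`Summit.HubbardSuperconductivity.HubbardSuperconductivity.Theorems.CwSsbToEvenTorusLRO.stub_torusPoincare`, statement verbatim the registered one).

/-- **Stub S2 — Kac-scale block order of EVERY sector ground state (thermodynamic, SSB-fed, guarded; OPEN).** Under the crux
hypotheses at `(U, δ, μ)`: a Kac scale `R_L` (`0 < R_L`, `R_L/L → 0`, `R_L³/L² → ∞`) and a floor `a > 0` such that, eventually along
the even sides `L = 2k+2`, every normalised `(N_L, S^z=0)`-sector ground state `ψ` of `hubbardTorus 2 L 1 U` has block coherence
`re⟨ψ, W_{R_L} ψ⟩ ≥ a L²`, `W_R = R⁻⁴ Σ_x B_xᴴ B_x`. -/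
theorem stub_kacBlockOrder :
    ∃ U₀ : ℝ, 0 < U₀ ∧ ∀ U ∈ Set.Ioo (0:ℝ) U₀, ∀ δ ∈ Set.Ioo (0:ℝ) (1 / 2), ∀ μ : ℝ,
      Filter.Tendsto (fun L : ℕ => ((hubbardTorusWith 2 (L + 1) 1 U μ).groundStateFunctional totalNumber).re / ((L + 1 : ℕ) : ℝ) ^ 2) Filter.atTop (nhds (1 - δ)) →
      HasDWaveOrder U μ →
      ∃ R : ℕ → ℕ, (∀ L, 0 < R L) ∧
        Filter.Tendsto (fun L : ℕ => (R L : ℝ) / (L : ℝ)) Filter.atTop (nhds 0) ∧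
        Filter.Tendsto (fun L : ℕ => (R L : ℝ) ^ 3 / (L : ℝ) ^ 2) Filter.atTop Filter.atTop ∧
        ∃ a : ℝ, 0 < a ∧ ∀ᶠ k : ℕ in Filter.atTop, ∀ ψ : Fock (Orb (FermionTorus 2 (2 * k + 1 + 1))),
          IsGroundStateInSector (hubbardTorus 2 (2 * k + 1 + 1) 1 U) (2 * ⌊(1 - δ) * (((2 * k + 1 + 1) : ℕ) : ℝ) ^ 2 / 2⌋₊) 0 ψ →
          star ψ ⬝ᵥ ψ = 1 →
            a * ((2 * k + 1 + 1 : ℕ) : ℝ) ^ 2 ≤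
              (star ψ ⬝ᵥ ((((((R (2 * k + 1 + 1) : ℝ) ^ 4)⁻¹ : ℝ) : ℂ) •
                ∑ x : Literature.Probability.LatticeModels.TorusSite 2 (2 * k + 1 + 1),
                  ((∑ u : Fin 2 → Fin (R (2 * k + 1 + 1)), localPair dWaveFormFactor (2 * k + 1 + 1) (x + fun i => ((u i : ℕ) : ZMod (2 * k + 1 + 1)))))ᴴ *
                  ((∑ u : Fin 2 → Fin (R (2 * k + 1 + 1)), localPair dWaveFormFactor (2 * k + 1 + 1) (x + fun i => ((u i : ℕ) : ZMod (2 * k + 1 + 1)))))) *ᵥ ψ)).re := by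
  sorry

/-- **Stub S3 — sub-critical anti-stiffness stability (O(1), all states, unguarded; OPEN).** For every weak coupling, every doping
in `(0, 1/2)`, every Kac scale `R_L` and every `η > 0` there is a rate `γ > 0` such that, eventually along the even sides
`L = 2k+2`, every unit vector `φ` of the `(N_L, S^z = 0)` sector satisfies
`γ · (Q_{R_L}(φ) − η) ≤ re⟨φ, H φ⟩ − E_sec`, `Q_R(φ) = R⁻⁴ Σ_x Σ_i ‖(B_{x+eᵢ} − B_x) φ‖²`, `H = hubbardTorus 2 L 1 U`. -/
theorem stub_stiffness :
    ∃ U₀ : ℝ, 0 < U₀ ∧ ∀ U ∈ Set.Ioo (0:ℝ) U₀, ∀ δ ∈ Set.Ioo (0:ℝ) (1 / 2), ∀ R : ℕ → ℕ,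
      (∀ L, 0 < R L) → Filter.Tendsto (fun L : ℕ => (R L : ℝ) / (L : ℝ)) Filter.atTop (nhds 0) →
      Filter.Tendsto (fun L : ℕ => (R L : ℝ) ^ 3 / (L : ℝ) ^ 2) Filter.atTop Filter.atTop →
      ∀ η : ℝ, 0 < η → ∃ γ : ℝ, 0 < γ ∧ ∀ᶠ k : ℕ in Filter.atTop, ∀ φ : Fock (Orb (FermionTorus 2 (2 * k + 1 + 1))),
        φ ∈ szSector (2 * ⌊(1 - δ) * (((2 * k + 1 + 1) : ℕ) : ℝ) ^ 2 / 2⌋₊) (0 : ℝ) → star φ ⬝ᵥ φ = 1 →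
          γ * ((∑ x : Literature.Probability.LatticeModels.TorusSite 2 (2 * k + 1 + 1), ∑ i : Fin 2,
                (star (((∑ u : Fin 2 → Fin (R (2 * k + 1 + 1)), localPair dWaveFormFactor (2 * k + 1 + 1) (x + Pi.single i 1 + fun j => ((u j : ℕ) : ZMod (2 * k + 1 + 1)))) *ᵥ φ) -
                    ((∑ u : Fin 2 → Fin (R (2 * k + 1 + 1)), localPair dWaveFormFactor (2 * k + 1 + 1) (x + fun j => ((u j : ℕ) : ZMod (2 * k + 1 + 1)))) *ᵥ φ)) ⬝ᵥ
                  (((∑ u : Fin 2 → Fin (R (2 * k + 1 + 1)), localPair dWaveFormFactor (2 * k + 1 + 1) (x + Pi.single i 1 + fun j => ((u j : ℕ) : ZMod (2 * k + 1 + 1)))) *ᵥ φ) -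
                    ((∑ u : Fin 2 → Fin (R (2 * k + 1 + 1)), localPair dWaveFormFactor (2 * k + 1 + 1) (x + fun j => ((u j : ℕ) : ZMod (2 * k + 1 + 1)))) *ᵥ φ))).re) /
              (R (2 * k + 1 + 1) : ℝ) ^ 4 - η) ≤
            (star φ ⬝ᵥ (hubbardTorus 2 (2 * k + 1 + 1) 1 U *ᵥ φ)).re -
              (hubbardTorus 2 (2 * k + 1 + 1) 1 U).minEnergyOn (szSector (2 * ⌊(1 - δ) * (((2 * k + 1 + 1) : ℕ) : ℝ) ^ 2 / 2⌋₊) (0 : ℝ)) := by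
  sorry

/-! ## Composition (sorry-free) -/

/-- Real bookkeeping of the closure on one side: `S = Σ‖B_xψ‖²`, `G = ΣΣ‖(B_{x+eᵢ}−B_x)ψ‖²`, `E = re⟨ψ,P†Pψ⟩`, `A = L²`, `B = L⁴`,
`Q = R⁴`; inputs S2 (`hBO`), S3 on a ground state (`hSt`), S1 (`hP`). -/
theorem closure_arith {S G E A B Q a η γ : ℝ} (hA : 0 < A) (hQ : 0 < Q) (hγ : 0 < γ) (hBA : B = A ^ 2)
    (hBO : a * A ≤ Q⁻¹ * S) (hSt : γ * (G / Q - η) ≤ 0) (hP : A * S - B * G ≤ Q * E) (hη : η = a / 2) :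
    a / 2 * B ≤ E := by
  subst hη hBA
  have hS : a * A * Q ≤ S := by
    rw [← le_div_iff₀ hQ, div_eq_inv_mul]
    exact hBO
  have hG : G ≤ a / 2 * Q := by
    have h1 : G / Q - a / 2 ≤ 0 := by
      have h' : γ * (G / Q - a / 2) ≤ γ * 0 := by rwa [mul_zero]
      exact le_of_mul_le_mul_left h' hγ
    have h2 : G / Q ≤ a / 2 := by linarith
    rwa [div_le_iff₀ hQ] at h2
  have h3 : Q * (a / 2 * A ^ 2) ≤ Q * E := by
    calc Q * (a / 2 * A ^ 2) = A * (a * A * Q) - A ^ 2 * (a / 2 * Q) := by ring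
      _ ≤ A * S - A ^ 2 * G := by nlinarith [hS, hG, hA]
      _ ≤ Q * E := hP
  exact le_of_mul_le_mul_left h3 hQ

/-- **The skeleton theorem.** S1 + S2 + S3 and the twin's LANDED kernel `hasDWavePairFieldLROAt_of_floor` conclude the crux
`CwSsbToEvenTorusLRO` BY NAME. -/
theorem CwSsbToEvenTorusLRO_of :
    Summit.HubbardSuperconductivity.HubbardSuperconductivity.Theses.ChiralWindow.CwSsbToEvenTorusLRO := by
  obtain ⟨U₁, hU₁, h1⟩ := stub_kacBlockOrder
  obtain ⟨U₂, hU₂, h2⟩ := stub_stiffness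
  refine ⟨min U₁ U₂, lt_min hU₁ hU₂, fun U hU δ hδ μ hdm hord => ?_⟩
  obtain ⟨R, hRpos, hR0, hR3, a, ha, hBO⟩ :=
    h1 U ⟨hU.1, lt_of_lt_of_le hU.2 (min_le_left _ _)⟩ δ hδ μ hdm hord
  obtain ⟨γ, hγ, hSt⟩ :=
    h2 U ⟨hU.1, lt_of_lt_of_le hU.2 (min_le_right _ _)⟩ δ hδ R hRpos hR0 hR3 (a / 2) (half_pos ha)
  refine hasDWavePairFieldLROAt_of_floor ⟨a / 2, half_pos ha, ?_⟩
  filter_upwards [hBO, hSt] with k hk hk'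
  intro ψ hψ hψ1
  have hLr : (0 : ℝ) < ((2 * k + 1 + 1 : ℕ) : ℝ) ^ 2 := by positivity
  have hRr : (0 : ℝ) < ((R (2 * k + 1 + 1) : ℕ) : ℝ) ^ 4 := by
    have := hRpos (2 * k + 1 + 1)
    positivity
  -- S2 on ψ
  have hB := hk ψ hψ hψ1
  -- S3 on ψ: the excess energy of a sector ground state vanishes
  have hS := hk' ψ hψ.1 hψ1
  have hE : (star ψ ⬝ᵥ (hubbardTorus 2 (2 * k + 1 + 1) 1 U *ᵥ ψ)).re -
      (hubbardTorus 2 (2 * k + 1 + 1) 1 U).minEnergyOn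
        (szSector (2 * ⌊(1 - δ) * (((2 * k + 1 + 1 : ℕ) : ℝ)) ^ 2 / 2⌋₊) (0 : ℝ)) = 0 := by
    rw [hψ.2.2, dotProduct_smul, hψ1, smul_eq_mul, mul_one, Complex.ofReal_re, sub_self]
  rw [hE] at hS
  -- S1 with v_x := B_x ψ
  have hP := stub_torusPoincare (2 * k + 1 + 1) (Finset (Orb (FermionTorus 2 (2 * k + 1 + 1))))
    (fun x => (∑ u : Fin 2 → Fin (R (2 * k + 1 + 1)),
      localPair dWaveFormFactor (2 * k + 1 + 1) (x + fun i => ((u i : ℕ) : ZMod (2 * k + 1 + 1)))) *ᵥ ψ)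
  -- Σ_x B_x ψ = R² P ψ, so the right side of S1 is R⁴ re⟨ψ, P†P ψ⟩
  have hsum : ∑ x : Literature.Probability.LatticeModels.TorusSite 2 (2 * k + 1 + 1),
      (∑ u : Fin 2 → Fin (R (2 * k + 1 + 1)),
        localPair dWaveFormFactor (2 * k + 1 + 1) (x + fun i => ((u i : ℕ) : ZMod (2 * k + 1 + 1)))) *ᵥ ψ =
      (((R (2 * k + 1 + 1) : ℕ) : ℂ) ^ 2) • (pairField dWaveFormFactor (2 * k + 1 + 1) *ᵥ ψ) := by
    rw [← Matrix.sum_mulVec, sum_blockPair, Matrix.smul_mulVec]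
  have hsq : (star ((((R (2 * k + 1 + 1) : ℕ) : ℂ) ^ 2) • (pairField dWaveFormFactor (2 * k + 1 + 1) *ᵥ ψ)) ⬝ᵥ
      ((((R (2 * k + 1 + 1) : ℕ) : ℂ) ^ 2) • (pairField dWaveFormFactor (2 * k + 1 + 1) *ᵥ ψ))).re =
      ((R (2 * k + 1 + 1) : ℕ) : ℝ) ^ 4 *
        (expect ((pairField dWaveFormFactor (2 * k + 1 + 1))ᴴ * pairField dWaveFormFactor (2 * k + 1 + 1)) ψ).re := by
    rw [← eucNorm_sq, eucNorm_smul, mul_pow, eucNorm_sq, ← PosSemidefTrace.expect_conjTranspose_mul]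
    have e1 : ‖((R (2 * k + 1 + 1) : ℕ) : ℂ) ^ 2‖ ^ 2 = ((R (2 * k + 1 + 1) : ℕ) : ℝ) ^ 4 := by
      rw [norm_pow, Complex.norm_natCast]; ring
    rw [e1]
  rw [hsum, hsq] at hP
  -- S2's right side: re⟨ψ, W ψ⟩ = R⁻⁴ Σ_x ‖B_x ψ‖²
  rw [re_expect_blockRepulsion, Complex.re_sum] at hB
  exact closure_arith hLr hRr hγ (by ring) hB hS hP rfl

end Summit.HubbardSuperconductivity.HubbardSuperconductivity.Cruxes.CwSsbToEvenTorusLRO.KacStiffnessPoincareClosure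

end
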